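import Mathlib
import HarnessLib
import Literature.MathematicalPhysics.QuantumFieldTheory.ConstructiveQFTWave0
import Summits.Ventures.LatticeQCDFlow.Scaling.LatticeEntropy

/-!
# LatticeQCDFlow / Scaling — the peeling bound T2-AH(b), PROVED
(THEORY-2.md §3.2 v2.0 (b), §4 T2-AH, R-T2-10)

HONEST FRAMING: exact (Metropolis-corrected) sampling algorithms for lattice gauge theory;
figures of merit are autocorrelation/cost numbers at stated couplings and volumes; no
continuum-physics claim.

`theorem peelingBound (d : ℕ) : PeelingBound d` — for the Wilson action
`S = Σ_p (N − Re tr ρ(U_p))` of ANY continuous unitary-type representation (`Re tr ρ ≤ N`) of ANY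
compact second-countable group on the torus `(ℤ/L)^d`, `L ≥ 2`, `β ≥ 0`:
`Z_Λ(β) ≤ Z₁(β)^{(d−1)·L^{d−1}·(L−1)}` (`Z₁` = one-plaquette partition function).  With the
small-ball lower bound (`Scaling/LatticeEntropy.lean: smallBallBound`, and the sharper tree-gauge
form `TreeGaugeSmallBallBound`, typed) this is the UPPER half of the two-sided law
`D(p_β ‖ Haar) ≍ (dim G/2)·(d−1)·V·log β` (THEORY-2.md §3.2 v2.0 (d), `EntropyGrowth`), i.e. the
volume- AND coupling-extensive training target of an exact flow (`Scaling/EntropyBudget.lean`: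
`D(p‖η) + log ESS ≤ log M + E log J`).

Proof (≈ 300 lines, no gauge fixing needed): (1) drop the spatial plaquettes and the top time
slice — every plaquette weight is `≤ 1` (`weight_le_prod_plaqWeight`); (2) each kept temporal
plaquette `(x; 0, j)` owns the PRIVATE link `(x + e₀, j)`, which no other kept plaquette of time
`≤` its own contains (`plaqWeight_update_of_kept`); (3) integrating that link alone turns the
plaquette weight into the constant `z₁(β)` whatever the other three links are — cyclicity of the
trace and LEFT invariance of Haar measure (`lintegral_weight_conj`; right invariance / unimodularity
is not used); (4) induct over the kept plaquettes in order of decreasing time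
(`Finset.induction_on_max_value`, one `lmarginal` over a singleton per step:
`lintegral_prod_plaqWeight_le`); (5) count: `|K| = (d−1)·L^{d−1}·(L−1)` (`card_keptSet`, by explicit
equivalences).  Measurability of the weights for the product σ-algebra uses
`SecondCountableTopology G` (`Pi.opensMeasurableSpace`).  Axioms: propext, Classical.choice,
Quot.sound.
-/

namespace Summit.Ventures.LatticeQCDFlow.Theory2.Lattice

open MeasureTheory Literature.MathematicalPhysics.QuantumFieldTheory

/-! ## Peeling (T2-AH(b)): `Z_Λ(β) ≤ Z₁(β)^{(d−1)·L^{d−1}·(L−1)}`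

Time is coordinate `0`; the kept plaquettes are the temporal ones `(x; 0, j)`, `0 < j`, with
`(x 0).val + 1 < L`; the private link of `(x; i, j)` is its second link `(x + eᵢ, j)`, which
enters the holonomy un-inverted in the middle, `U_p = U(x,i)·g·U(x+e_j,i)⁻¹·U(x,j)⁻¹`; by
cyclicity of the trace the weight is a function of `(U(x+e_j,i)⁻¹U(x,j)⁻¹U(x,i))·g`, so LEFT
invariance of Haar measure integrates it to `z₁` whatever the other links are.  Plaquettes are
removed in order of decreasing time (`Finset.induction_on_max_value`), one `lmarginal` over a
single coordinate at a time. -/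

section Peeling

variable {N : ℕ} {G : Type*} [Group G] [TopologicalSpace G] [IsTopologicalGroup G]
  [CompactSpace G] [MeasurableSpace G] [BorelSpace G] (ρ : G →* Matrix (Fin N) (Fin N) ℂ)

/-- The action of one plaquette, `s_p(U) = N − Re tr ρ(U_p)`. [folklore] -/
def plaqAction {d L : ℕ} (U : GaugeConfig d L G) (p : Plaquette d L) : ℝ :=
  (N : ℝ) - (ρ (plaquetteHolonomy U p.1 p.2.1.1 p.2.1.2)).trace.re

/-- The Boltzmann weight of one plaquette as an extended non-negative real,
`w_p(U) = exp(−β·s_p(U))`. [folklore] -/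
noncomputable def plaqWeight {d L : ℕ} (β : ℝ) (p : Plaquette d L) (U : GaugeConfig d L G) :
    ENNReal :=
  ENNReal.ofReal (Real.exp (-(β * plaqAction ρ U p)))

/-- The one-plaquette integral `z₁(β) = ∫ exp(−β(N − Re tr ρ g)) dHaar(g)` in `ℝ≥0∞`
(`onePlaquetteZ = z₁.toReal`). [folklore] -/
noncomputable def z1 (β : ℝ) : ENNReal :=
  ∫⁻ g, ENNReal.ofReal (Real.exp (-(β * ((N : ℝ) - (ρ g).trace.re)))) ∂(haarProbability G)

omit [TopologicalSpace G] [IsTopologicalGroup G] [CompactSpace G] [MeasurableSpace G]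
  [BorelSpace G] in
/-- The Wilson action is the sum of the plaquette actions. [folklore] -/
theorem wilsonAction_eq_sum_plaqAction {d L : ℕ} [NeZero L] (U : GaugeConfig d L G) :
    wilsonAction ρ U = ∑ p : Plaquette d L, plaqAction ρ U p := rfl

omit [TopologicalSpace G] [IsTopologicalGroup G] [CompactSpace G] [MeasurableSpace G]
  [BorelSpace G] in
/-- Each plaquette action is non-negative when `Re tr ρ ≤ N`. [folklore] -/
theorem plaqAction_nonneg {d L : ℕ} (htr : ∀ g, (ρ g).trace.re ≤ N) (U : GaugeConfig d L G)
    (p : Plaquette d L) : 0 ≤ plaqAction ρ U p :=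
  sub_nonneg.mpr (htr _)

omit [TopologicalSpace G] [IsTopologicalGroup G] [CompactSpace G] [MeasurableSpace G]
  [BorelSpace G] in
/-- Dropping plaquettes: `exp(−β S(U)) ≤ ∏_{p ∈ K} w_p(U)` for every set `K` of plaquettes
(`β ≥ 0`, all plaquette actions `≥ 0`). [folklore] -/
theorem weight_le_prod_plaqWeight {d L : ℕ} [NeZero L] (htr : ∀ g, (ρ g).trace.re ≤ N)
    {β : ℝ} (hβ : 0 ≤ β) (K : Finset (Plaquette d L)) (U : GaugeConfig d L G) :
    ENNReal.ofReal (Real.exp (-β * wilsonAction ρ U)) ≤ ∏ p ∈ K, plaqWeight ρ β p U := by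
  unfold plaqWeight
  rw [← ENNReal.ofReal_prod_of_nonneg (fun p _ => Real.exp_nonneg _), ← Real.exp_sum]
  refine ENNReal.ofReal_le_ofReal (Real.exp_le_exp.mpr ?_)
  rw [wilsonAction_eq_sum_plaqAction, Finset.sum_neg_distrib, ← Finset.mul_sum, neg_mul]
  have h := Finset.sum_le_sum_of_subset_of_nonneg (f := fun p => plaqAction ρ U p)
    (Finset.subset_univ K) (fun p _ _ => plaqAction_nonneg ρ htr U p)
  have := mul_le_mul_of_nonneg_left h hβ
  linarith

/-- In `ZMod L`, `L ≥ 2`, `1 ≠ 0`; hence `x + eᵢ ≠ x` on the torus. [folklore] -/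
theorem shift_ne_self {d L : ℕ} [NeZero L] (hL : 2 ≤ L) (x : Site d L) (i : Fin d) :
    x.shift i ≠ x := by
  haveI : Fact (1 < L) := ⟨hL⟩
  intro h
  have h1 : (x.shift i) i = x i := by rw [h]
  simp [Site.shift] at h1

omit [TopologicalSpace G] [IsTopologicalGroup G] [CompactSpace G] [MeasurableSpace G]
  [BorelSpace G] in
/-- The holonomy of the plaquette `(x; i, j)`, `i < j`, after updating its second link
`(x + eᵢ, j)` to `g`: `U(x,i) · g · U(x+e_j,i)⁻¹ · U(x,j)⁻¹` — the other three links are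
different edges (`L ≥ 2`). [folklore] -/
theorem plaquetteHolonomy_update_second {d L : ℕ} [NeZero L] (hL : 2 ≤ L)
    (U : GaugeConfig d L G) (x : Site d L) {i j : Fin d} (hij : i < j) (g : G) :
    plaquetteHolonomy (Function.update U (x.shift i, j) g) x i j =
      U (x, i) * g * (U (x.shift j, i))⁻¹ * (U (x, j))⁻¹ := by
  have hne : i ≠ j := ne_of_lt hij
  unfold plaquetteHolonomy
  rw [Function.update_self,
    Function.update_of_ne (show ((x, i) : Edge d L) ≠ (x.shift i, j) from
      fun h => hne (congrArg Prod.snd h)),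
    Function.update_of_ne (show ((x.shift j, i) : Edge d L) ≠ (x.shift i, j) from
      fun h => hne (congrArg Prod.snd h)),
    Function.update_of_ne (show ((x, j) : Edge d L) ≠ (x.shift i, j) from
      fun h => shift_ne_self hL x i (congrArg Prod.fst h).symm)]

/-- The normalised Haar measure is left invariant. [folklore] -/
instance isMulLeftInvariant_haarProbability : (haarProbability G).IsMulLeftInvariant := by
  unfold haarProbability; infer_instance

/-- **Haar averaging of one plaquette**: `∫ exp(−β(N − Re tr ρ(a·g·b·c))) dHaar(g) = z₁(β)`
for all `a, b, c` — cyclicity of the trace and LEFT invariance of Haar measure. [folklore] -/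
theorem lintegral_weight_conj [SecondCountableTopology G] (β : ℝ) (a b c : G) :
    ∫⁻ g, ENNReal.ofReal (Real.exp (-(β * ((N : ℝ) - (ρ (a * g * b * c)).trace.re))))
        ∂(haarProbability G) = z1 ρ β := by
  have hcyc : ∀ g : G, (ρ (a * g * b * c)).trace = (ρ (b * c * a * g)).trace := fun g => by
    rw [show a * g * b * c = (a * g) * (b * c) by simp only [mul_assoc], map_mul,
      Matrix.trace_mul_comm, ← map_mul, show b * c * (a * g) = b * c * a * g by
        simp only [mul_assoc]]
  simp_rw [hcyc]
  exact lintegral_mul_left_eq_self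
    (fun g => ENNReal.ofReal (Real.exp (-(β * ((N : ℝ) - (ρ g).trace.re))))) (b * c * a)

omit [CompactSpace G] in
/-- Continuity of the one-plaquette weight in the configuration (continuous `ρ`). [folklore] -/
theorem measurable_plaqWeight [SecondCountableTopology G] {d L : ℕ} [NeZero L]
    (hρ : Continuous (ρ : G → Matrix (Fin N) (Fin N) ℂ)) (β : ℝ) (p : Plaquette d L) :
    Measurable (plaqWeight (G := G) ρ β p) := by
  unfold plaqWeight plaqAction plaquetteHolonomy
  have h1 : Continuous fun U : GaugeConfig d L G =>
      U (p.1, p.2.1.1) * U (p.1.shift p.2.1.1, p.2.1.2) * (U (p.1.shift p.2.1.2, p.2.1.1))⁻¹ *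
        (U (p.1, p.2.1.2))⁻¹ := by
    fun_prop
  have h2 : Continuous fun U : GaugeConfig d L G =>
      (ρ (U (p.1, p.2.1.1) * U (p.1.shift p.2.1.1, p.2.1.2) * (U (p.1.shift p.2.1.2, p.2.1.1))⁻¹ *
        (U (p.1, p.2.1.2))⁻¹)).trace.re :=
    Complex.continuous_re.comp (hρ.comp h1).matrix_trace
  have h0 : Continuous fun t : ℝ => Real.exp (-(β * ((N : ℝ) - t))) := by fun_prop
  have h3 : Continuous fun U : GaugeConfig d L G => Real.exp (-(β * ((N : ℝ) -
      (ρ (U (p.1, p.2.1.1) * U (p.1.shift p.2.1.1, p.2.1.2) * (U (p.1.shift p.2.1.2, p.2.1.1))⁻¹ *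
        (U (p.1, p.2.1.2))⁻¹)).trace.re))) :=
    h0.comp h2
  exact h3.measurable.ennreal_ofReal

/-- The kept plaquettes (`d = d'+1`, time = coordinate `0`): temporal, `i = 0`, and not in the
top time slice, `(x 0).val + 1 < L`. [folklore] -/
def keptSet (d' L : ℕ) [NeZero L] : Finset (Plaquette (d' + 1) L) :=
  Finset.univ.filter fun p => p.2.1.1 = 0 ∧ (p.1 0).val + 1 < L

/-- Membership in `keptSet`. [folklore] -/
theorem mem_keptSet {d' L : ℕ} [NeZero L] {p : Plaquette (d' + 1) L} :
    p ∈ keptSet d' L ↔ p.2.1.1 = 0 ∧ (p.1 0).val + 1 < L := by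
  simp [keptSet]

omit [TopologicalSpace G] [IsTopologicalGroup G] [CompactSpace G] [MeasurableSpace G]
  [BorelSpace G] in
/-- **Private link.** Updating the second link `(x + e₀, j)` of a kept plaquette `a = (x; 0, j)`
does not change the weight of any other kept plaquette `p` of time `≤` the time of `a`: none of
the four links of `p` is that link. [folklore] -/
theorem plaqWeight_update_of_kept {d' L : ℕ} [NeZero L] (hL : 2 ≤ L) (β : ℝ)
    {a p : Plaquette (d' + 1) L} (ha : a ∈ keptSet d' L) (hp : p ∈ keptSet d' L) (hpa : p ≠ a)
    (htime : (p.1 0).val ≤ (a.1 0).val) (U : GaugeConfig (d' + 1) L G) (g : G) :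
    plaqWeight ρ β p (Function.update U (a.1.shift a.2.1.1, a.2.1.2) g) = plaqWeight ρ β p U := by
  haveI : Fact (1 < L) := ⟨hL⟩
  obtain ⟨ha1, ha2⟩ := mem_keptSet.mp ha
  obtain ⟨hp1, hp2⟩ := mem_keptSet.mp hp
  have hj : a.2.1.2 ≠ 0 := by
    intro h; have hlt := a.2.2; rw [ha1, h] at hlt; exact lt_irrefl _ hlt
  have e1 : ((p.1, p.2.1.1) : Edge (d' + 1) L) ≠ (a.1.shift a.2.1.1, a.2.1.2) := by
    intro h; have h2 : p.2.1.1 = a.2.1.2 := congrArg Prod.snd h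
    rw [hp1] at h2; exact hj h2.symm
  have e3 : ((p.1.shift p.2.1.2, p.2.1.1) : Edge (d' + 1) L) ≠ (a.1.shift a.2.1.1, a.2.1.2) := by
    intro h; have h2 : p.2.1.1 = a.2.1.2 := congrArg Prod.snd h
    rw [hp1] at h2; exact hj h2.symm
  have e2 : ((p.1.shift p.2.1.1, p.2.1.2) : Edge (d' + 1) L) ≠ (a.1.shift a.2.1.1, a.2.1.2) := by
    intro h
    apply hpa
    have h1 : p.1.shift p.2.1.1 = a.1.shift a.2.1.1 := congrArg Prod.fst h
    rw [hp1, ha1] at h1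
    unfold Site.shift at h1
    have h1' : p.1 = a.1 := add_right_cancel h1
    have h2' : p.2.1.2 = a.2.1.2 := (congrArg Prod.snd h :)
    have h2 : p.2.1 = a.2.1 := Prod.ext (by rw [hp1, ha1]) h2'
    exact Prod.ext h1' (Subtype.ext h2)
  have e4 : ((p.1, p.2.1.2) : Edge (d' + 1) L) ≠ (a.1.shift a.2.1.1, a.2.1.2) := by
    intro h
    have h1 : p.1 = a.1.shift a.2.1.1 := congrArg Prod.fst h
    rw [ha1] at h1
    have hval : (p.1 0).val = (a.1 0).val + 1 := by
      rw [h1]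
      simp only [Site.shift, Pi.add_apply, Pi.single_eq_same]
      rw [ZMod.val_add, ZMod.val_one, Nat.mod_eq_of_lt ha2]
    omega
  unfold plaqWeight plaqAction plaquetteHolonomy
  rw [Function.update_of_ne e1, Function.update_of_ne e2, Function.update_of_ne e3,
    Function.update_of_ne e4]

/-- **Peeling, inductive form.** For every set `s` of kept plaquettes,
`∫ ∏_{p ∈ s} w_p dHaar^{⊗E} ≤ z₁^{|s|}` — remove a plaquette of maximal time, integrate its
private link by `lintegral_weight_conj`, recurse (`Finset.induction_on_max_value`). [folklore] -/
theorem lintegral_prod_plaqWeight_le [SecondCountableTopology G] {d' L : ℕ} [NeZero L]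
    (hρ : Continuous (ρ : G → Matrix (Fin N) (Fin N) ℂ)) (hL : 2 ≤ L) (β : ℝ)
    (s : Finset (Plaquette (d' + 1) L)) (hs : ∀ p ∈ s, p ∈ keptSet d' L) :
    ∫⁻ U, ∏ p ∈ s, plaqWeight ρ β p U ∂(Measure.pi fun _ : Edge (d' + 1) L => haarProbability G)
      ≤ z1 ρ β ^ s.card := by
  classical
  revert hs
  refine Finset.induction_on_max_value (fun p : Plaquette (d' + 1) L => (p.1 0).val) s ?_ ?_
  · intro; simp
  · intro a s has hmax ih hins
    have ha : a ∈ keptSet d' L := hins a (Finset.mem_insert_self a s)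
    have hs : ∀ p ∈ s, p ∈ keptSet d' L := fun p hp => hins p (Finset.mem_insert_of_mem hp)
    have hF : Measurable fun U : GaugeConfig (d' + 1) L G => ∏ p ∈ s, plaqWeight ρ β p U :=
      Finset.measurable_prod s fun p _ => measurable_plaqWeight ρ hρ β p
    have hind : ∀ (U : GaugeConfig (d' + 1) L G) (g : G),
        ∏ p ∈ s, plaqWeight ρ β p (Function.update U (a.1.shift a.2.1.1, a.2.1.2) g) =
          ∏ p ∈ s, plaqWeight ρ β p U :=
      fun U g => Finset.prod_congr rfl fun p hp => plaqWeight_update_of_kept ρ hL β ha (hs p hp)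
        (fun h => has (h ▸ hp)) (hmax p hp) U g
    have key : ∫⁻ U, plaqWeight ρ β a U * ∏ p ∈ s, plaqWeight ρ β p U
          ∂(Measure.pi fun _ : Edge (d' + 1) L => haarProbability G)
        = ∫⁻ U, z1 ρ β * ∏ p ∈ s, plaqWeight ρ β p U
          ∂(Measure.pi fun _ : Edge (d' + 1) L => haarProbability G) := by
      refine lintegral_eq_of_lmarginal_eq {(a.1.shift a.2.1.1, a.2.1.2)}
        ((measurable_plaqWeight ρ hρ β a).mul hF) (measurable_const.mul hF) ?_
      rw [lmarginal_singleton, lmarginal_singleton]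
      funext U
      simp_rw [hind]
      have hmu : Measurable fun g : G =>
          plaqWeight ρ β a (Function.update U (a.1.shift a.2.1.1, a.2.1.2) g) :=
        (measurable_plaqWeight ρ hρ β a).comp (measurable_update U)
      rw [lintegral_mul_const _ hmu, lintegral_const, measure_univ, mul_one]
      congr 1
      simp only [plaqWeight, plaqAction, plaquetteHolonomy_update_second hL U a.1 a.2.2]
      exact lintegral_weight_conj ρ β _ _ _
    simp_rw [Finset.prod_insert has]
    rw [key, lintegral_const_mul _ hF, Finset.card_insert_of_notMem has, pow_succ']
    exact mul_le_mul' le_rfl (ih hs)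

/-! ### Counting the kept plaquettes: `|K| = (d−1)·L^{d−1}·(L−1)` -/

/-- Times below the top slice ≃ `Fin (L−1)`. [folklore] -/
def timeSliceEquiv (L : ℕ) [NeZero L] : {a : ZMod L // a.val + 1 < L} ≃ Fin (L - 1) where
  toFun a := ⟨a.1.val, by have := a.2; omega⟩
  invFun n := ⟨((n.1 : ℕ) : ZMod L), by
    have := n.2; rw [ZMod.val_natCast, Nat.mod_eq_of_lt (by omega)]; omega⟩
  left_inv a := Subtype.ext (ZMod.natCast_zmod_val a.1)
  right_inv n := Fin.ext (by
    have := n.2; simp only [ZMod.val_natCast]; exact Nat.mod_eq_of_lt (by omega))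

/-- Sites below the top time slice ≃ (time below the top) × (spatial coordinates). [folklore] -/
def keptSiteEquiv (d' L : ℕ) :
    {x : Site (d' + 1) L // (x 0).val + 1 < L} ≃ {a : ZMod L // a.val + 1 < L} × (Fin d' → ZMod L)
    where
  toFun x := (⟨x.1 0, x.2⟩, Fin.tail x.1)
  invFun y := ⟨(Fin.cons y.1.1 y.2 : Fin (d' + 1) → ZMod L), by
    simp only [Fin.cons_zero]; exact y.1.2⟩
  left_inv x := Subtype.ext (Fin.cons_self_tail x.1)
  right_inv y := by
    ext
    · simp
    · simp

/-- Temporal directions `(0, j)`, `0 < j ≤ d'` ≃ `Fin d'`. [folklore] -/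
def keptDirEquiv (d' : ℕ) :
    {q : {q : Fin (d' + 1) × Fin (d' + 1) // q.1 < q.2} // q.1.1 = 0} ≃ Fin d' where
  toFun q := q.1.1.2.pred (by
    intro h; have hlt := q.1.2; rw [q.2, h] at hlt; exact lt_irrefl _ hlt)
  invFun k := ⟨⟨(0, k.succ), Fin.succ_pos k⟩, rfl⟩
  left_inv q := by
    rcases q with ⟨⟨⟨i, j⟩, hij⟩, hi⟩
    simp only at hi
    subst hi
    simp
  right_inv k := by simp

/-- Kept plaquettes ≃ (sites below the top slice) × (temporal directions). [folklore] -/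
def keptPlaqEquiv (d' L : ℕ) :
    {p : Plaquette (d' + 1) L // p.2.1.1 = 0 ∧ (p.1 0).val + 1 < L} ≃
      {x : Site (d' + 1) L // (x 0).val + 1 < L} ×
        {q : {q : Fin (d' + 1) × Fin (d' + 1) // q.1 < q.2} // q.1.1 = 0} where
  toFun p := (⟨p.1.1, p.2.2⟩, ⟨p.1.2, p.2.1⟩)
  invFun y := ⟨(y.1.1, y.2.1), y.2.2, y.1.2⟩
  left_inv _ := rfl
  right_inv _ := rfl

/-- `|K| = d'·L^{d'}·(L−1)` kept plaquettes in dimension `d'+1`. [folklore] -/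
theorem card_keptSet (d' L : ℕ) [NeZero L] : (keptSet d' L).card = d' * L ^ d' * (L - 1) := by
  have h1 : (keptSet d' L).card =
      Fintype.card {p : Plaquette (d' + 1) L // p.2.1.1 = 0 ∧ (p.1 0).val + 1 < L} := by
    rw [Fintype.card_subtype]; rfl
  rw [h1, Fintype.card_congr (keptPlaqEquiv d' L), Fintype.card_prod,
    Fintype.card_congr (keptSiteEquiv d' L), Fintype.card_prod,
    Fintype.card_congr (timeSliceEquiv L), Fintype.card_fin,
    Fintype.card_congr (keptDirEquiv d'), Fintype.card_fin, Fintype.card_fun, ZMod.card,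
    Fintype.card_fin]
  ring

/-! ### Assembly of T2-AH(b) -/

/-- `z₁(β) ≤ 1` for `β ≥ 0` and `Re tr ρ ≤ N`. [folklore] -/
theorem z1_le_one (htr : ∀ g, (ρ g).trace.re ≤ N) {β : ℝ} (hβ : 0 ≤ β) : z1 ρ β ≤ 1 := by
  unfold z1
  calc ∫⁻ g, ENNReal.ofReal (Real.exp (-(β * ((N : ℝ) - (ρ g).trace.re)))) ∂(haarProbability G)
      ≤ ∫⁻ _, 1 ∂(haarProbability G) := by
        refine lintegral_mono fun g => ENNReal.ofReal_le_one.mpr (Real.exp_le_one_iff.mpr ?_)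
        have := htr g
        exact neg_nonpos.mpr (mul_nonneg hβ (sub_nonneg.mpr this))
    _ = 1 := by rw [lintegral_one, measure_univ]

/-- **T2-AH(b), PROVED — the peeling bound** `Z_Λ(β) ≤ Z₁(β)^{(d−1)·L^{d−1}·(L−1)}` for the
Wilson action over any compact second-countable `G`, `Re tr ρ ≤ N`, `β ≥ 0`, `L ≥ 2`
(THEORY-2.md §3.2 v2.0, R-T2-10). Proof: drop the spatial plaquettes and the top time slice
(`weight_le_prod_plaqWeight`), then integrate the kept plaquettes' private links one at a time
in order of decreasing time (`lintegral_prod_plaqWeight_le`: trace cyclicity + left Haar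
invariance), and count (`card_keptSet`). [folklore] -/
theorem peelingBound (d : ℕ) : PeelingBound d := by
  intro N G _ _ _ _ _ _ _ ρ hρ htr L _ hL β hβ
  have hZ1 : partitionFunction (d := d) (L := L) ρ β ≤ 1 := partitionFunction_le_one ρ htr hβ
  cases d with
  | zero =>
    simp only [Nat.zero_sub, zero_mul, pow_zero]
    calc (partitionFunction ρ β).toReal ≤ (1 : ENNReal).toReal :=
          ENNReal.toReal_mono ENNReal.one_ne_top hZ1
      _ = 1 := ENNReal.toReal_one
  | succ d' =>
    have hmain : partitionFunction (d := d' + 1) (L := L) ρ β ≤ z1 ρ β ^ (keptSet d' L).card := by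
      unfold partitionFunction wilsonWeight
      rw [withDensity_apply _ MeasurableSet.univ, Measure.restrict_univ]
      calc ∫⁻ U, ENNReal.ofReal (Real.exp (-β * wilsonAction ρ U))
            ∂(Measure.pi fun _ : Edge (d' + 1) L => haarProbability G)
          ≤ ∫⁻ U, ∏ p ∈ keptSet d' L, plaqWeight ρ β p U
            ∂(Measure.pi fun _ : Edge (d' + 1) L => haarProbability G) :=
            lintegral_mono fun U => weight_le_prod_plaqWeight ρ htr hβ _ U
        _ ≤ z1 ρ β ^ (keptSet d' L).card :=
            lintegral_prod_plaqWeight_le ρ hρ hL β _ (fun p hp => hp)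
    have hne : z1 ρ β ^ (keptSet d' L).card ≠ ⊤ :=
      ne_top_of_le_ne_top ENNReal.one_ne_top (pow_le_one₀ zero_le (z1_le_one ρ htr hβ))
    have h := ENNReal.toReal_mono hne hmain
    rw [ENNReal.toReal_pow, card_keptSet] at h
    have hexp : (d' + 1 - 1) * L ^ (d' + 1 - 1) * (L - 1) = d' * L ^ d' * (L - 1) := by
      simp only [Nat.add_sub_cancel]
    rw [hexp]
    exact h

end Peeling

end Summit.Ventures.LatticeQCDFlow.Theory2.Lattice
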